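import Summits.Ventures.CertifiedManyBodySolver.Observables.CanonicalCeilingClustersSourcedRows
import HarnessLib

/-!
# Decimal slots and TWO-SIDED BRACKETS of the t′ = 0 canonical response ceilings from the existing sourced rows
# (companion of `Observables/CanonicalCeilingClustersSourcedRows.lean`; same premises, same seat)

Cell hubbard-floor (D-0160 FLOOR cell FQ1; seat hubbard-floor-eng-1). §3: the ceiling `(A + B·g − E(g₂))/(2(√2·g₂ − √2·g))` of
`canonicalCeiling_n7o8_tp0_clusterline_of_row_g*` rounded UP to 7 dp (through `√2 > 1.4142135623`) at the FLOOR cell's pre-registered fields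
h_tree ∈ {0.15152, 0.20203, 0.25254, 0.30305, 0.35355, 0.40406, 0.50508, 0.60609, 0.70711}, each with the row that gives the smallest number
(`9/14` for the first, `5/7` for the rest). §4: where the p488242 floor `canonicalFloor_n7o8_tp0_clusterline_continuum` is positive
(`g > g× ≈ 0.2319672`) the TWO-SIDED bracket `Re ω(P₀^d) ∈ [floor↓, ceiling↑]` at `g ∈ {1/4, 2/7, 5/14, 3/7, 1/2}` — floor premises `#505` + the
two `4 × 3` cluster nodes, ceiling premises the two cluster nodes + one sourced row, listed separately in every statement (all CANDIDATE legs named).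
Numbers: ceilings 0.8868506 @ 0.15152 · 0.9136140 @ 0.20203 · 0.9423209 @ 0.25254 · 0.9751287 @ 0.30305 · 1.0129839 @ 0.35355 · 1.0571482 @ 0.40406 ·
1.1719756 @ 0.50508 · 1.3442167 @ 0.60609 · 1.6312851 @ 0.70711; brackets [0.0348402, 1.0129839] @ 0.35355 · [0.0908616, 1.0571482] @ 0.40406 ·
[0.1692915, 1.1719756] @ 0.50508 · [0.2215781, 1.3442167] @ 0.60609 · [0.2589257, 1.6312851] @ 0.70711 (widths 0.98–1.37).

SIZE, STATED PLAINLY: kinematic scale (K5-class zero-field one-point ceiling of record 0.6445); the brackets are CONSISTENT WITH ANY RESPONSE SHAPE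
below that scale, linear `m ≤ C·h` included, and exclude nothing else. HONEST FRAMING: finite-field RESPONSE brackets at LARGE pairing fields
(h_p = 4·h_tree) on infinite-volume ground states at fixed density ⅞, CONDITIONAL on the named claim nodes; «m(h) ∈ [m⁻, m⁺] at h = …,
CERTIFIED(KERNEL) modulo the nodes, class A0′» — never onset, gap, Tc or order; superconductivity in the Hubbard model is NOT proved or disproved
by any of this. Zero compute; no definition; no named fact; no `sorry`. References: R. B. Griffiths, Phys. Rev. 152 (1966) 240 §II; T. Koma,
H. Tasaki, J. Stat. Phys. 76 (1994) 745 §1.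
-/

noncomputable section

namespace Summit.Ventures.CertifiedManyBodySolver.Observables

open Matrix Finset Literature.Probability.LatticeModels
open Literature.MathematicalPhysics.QuantumLattice Literature.MathematicalPhysics.QuantumLattice.ThermodynamicLimit
open Literature.MathematicalPhysics.QuantumLattice.TwoCluster InfVolFermionState
open Summit.Ventures.CertifiedManyBodySolver Summit.Ventures.CertifiedManyBodySolver.Certificates
open scoped ComplexOrder

/-! ## §3  Decimal slots (7 dp, rounded UP through `√2 > 1.4142135623`) at the FLOOR cell's pre-registered fields, each with its best row -/

section Decimals

variable {ω : InfVolFermionState 2}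

/-- `1.4142135623 < √2`. [folklore] -/
private theorem sqrt_two_gt_14142135623' : (14142135623 / 10 ^ 10 : ℝ) < Real.sqrt 2 := by
  rw [Real.lt_sqrt (by norm_num)]; norm_num

/-- Slot rule for a ceiling: from `x ≤ N/(2(√2·g₂ − √2·g))` with `0 < g < g₂`, `0 ≤ N` and the decidable side condition
`N·10¹⁰ ≤ M·2·14142135623·(g₂ − g)` conclude `x ≤ M`. [folklore] -/
private theorem chord_le_of_decimal_bound {x N g g₂ M : ℝ} (hgg : g < g₂) (hN : 0 ≤ N)
    (hside : N * 10 ^ 10 ≤ M * (2 * 14142135623 * (g₂ - g))) (hx : x ≤ N / (2 * (Real.sqrt 2 * g₂ - Real.sqrt 2 * g))) : x ≤ M := by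
  have hs := sqrt_two_gt_14142135623'
  have hδ : 0 < g₂ - g := sub_pos.2 hgg
  have hden : 0 < 2 * (Real.sqrt 2 * g₂ - Real.sqrt 2 * g) := by
    have : Real.sqrt 2 * g₂ - Real.sqrt 2 * g = Real.sqrt 2 * (g₂ - g) := by ring
    rw [this]; positivity
  refine hx.trans ?_
  rw [div_le_iff₀ hden]
  have hM : 0 ≤ M := by
    by_contra hM'
    have : M * (2 * 14142135623 * (g₂ - g)) < 0 := mul_neg_of_neg_of_pos (not_le.mp hM') (by positivity)
    nlinarith
  nlinarith [mul_le_mul_of_nonneg_left hs.le (by positivity : (0:ℝ) ≤ M * (2 * (g₂ - g)))]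

/-- **Ceiling slot at `g = 3/28` (`h_tree ≈ 0.15152`): `Re ω(P₀^d) ≤ 0.8868506`** for every translation-invariant density-`7/8` minimiser of
`E_{√2·3/28}` (best row: `g₂ = 9/14`; exact chord `(A + B·g − E(g₂))/(2√2(g₂ − g))` rounded UP to 7 dp); no positive floor at this field (ℓ₅₀₅ chord margin -0.1705303). CONDITIONAL on the two cluster nodes +
`cert_pin1menuA0p_L3h0_U8_tp0_g9o14_E_j287398` (CANDIDATE). Kinematic scale; never speaks to presence. [cite: Griffiths1966, §II] -/
theorem canonicalCeiling_n7o8_tp0_clusterline_decimal_g3o28 (hω : ω.IsTranslationInvariant) (hρ : ω.density = 7 / 8)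
    (hmin : ∀ ω' : InfVolFermionState 2, ω'.IsTranslationInvariant → ω'.density = 7 / 8 →
      ω.meanEnergy (hubbardTTPrimeSourcedInteraction 1 0 8 0 dWaveFormFactor (Real.sqrt 2 * (3 / 28 : ℝ))) 1 ≤
        ω'.meanEnergy (hubbardTTPrimeSourcedInteraction 1 0 8 0 dWaveFormFactor (Real.sqrt 2 * (3 / 28 : ℝ))) 1)
    (hC₁ : cert_capU2x2_4x3_U8_tp0_g3o14_mu3o2) (hC₂ : cert_capU3x2_4x3_U8_tp0_g1o4_mu7o4) (hN : cert_pin1menuA0p_L3h0_U8_tp0_g9o14_E_j287398) :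
    (ω.expect (pairRegion (insert (0 : Site 2) unitSteps) 0) (localPairAt (insert 0 unitSteps) dWaveFormFactor 0)).re ≤ (4434253 / 5000000 : ℝ) :=
  chord_le_of_decimal_bound (by norm_num) (by push_cast; norm_num) (by push_cast; norm_num)
    (canonicalCeiling_n7o8_tp0_clusterline_of_row_g9o14 (3 / 28 : ℝ) (by norm_num) (by norm_num) hω hρ hmin hC₁ hC₂ hN)

/-- **Ceiling slot at `g = 1/7` (`h_tree ≈ 0.20203`): `Re ω(P₀^d) ≤ 0.9136140`** for every translation-invariant density-`7/8` minimiser of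
`E_{√2·1/7}` (best row: `g₂ = 5/7`; exact chord `(A + B·g − E(g₂))/(2√2(g₂ − g))` rounded UP to 7 dp); no positive floor at this field (ℓ₅₀₅ chord margin -0.1217388). CONDITIONAL on the two cluster nodes +
`cert_pin1menuA0p_L3h0_U8_tp0_g5o7_E_j287398` (CANDIDATE). Kinematic scale; never speaks to presence. [cite: Griffiths1966, §II] -/
theorem canonicalCeiling_n7o8_tp0_clusterline_decimal_g1o7 (hω : ω.IsTranslationInvariant) (hρ : ω.density = 7 / 8)
    (hmin : ∀ ω' : InfVolFermionState 2, ω'.IsTranslationInvariant → ω'.density = 7 / 8 →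
      ω.meanEnergy (hubbardTTPrimeSourcedInteraction 1 0 8 0 dWaveFormFactor (Real.sqrt 2 * (1 / 7 : ℝ))) 1 ≤
        ω'.meanEnergy (hubbardTTPrimeSourcedInteraction 1 0 8 0 dWaveFormFactor (Real.sqrt 2 * (1 / 7 : ℝ))) 1)
    (hC₁ : cert_capU2x2_4x3_U8_tp0_g3o14_mu3o2) (hC₂ : cert_capU3x2_4x3_U8_tp0_g1o4_mu7o4) (hN : cert_pin1menuA0p_L3h0_U8_tp0_g5o7_E_j287398) :
    (ω.expect (pairRegion (insert (0 : Site 2) unitSteps) 0) (localPairAt (insert 0 unitSteps) dWaveFormFactor 0)).re ≤ (456807 / 500000 : ℝ) :=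
  chord_le_of_decimal_bound (by norm_num) (by push_cast; norm_num) (by push_cast; norm_num)
    (canonicalCeiling_n7o8_tp0_clusterline_of_row_g5o7 (1 / 7 : ℝ) (by norm_num) (by norm_num) hω hρ hmin hC₁ hC₂ hN)

/-- **Ceiling slot at `g = 5/28` (`h_tree ≈ 0.25254`): `Re ω(P₀^d) ≤ 0.9423209`** for every translation-invariant density-`7/8` minimiser of
`E_{√2·5/28}` (best row: `g₂ = 5/7`; exact chord `(A + B·g − E(g₂))/(2√2(g₂ − g))` rounded UP to 7 dp); no positive floor at this field (ℓ₅₀₅ chord margin -0.0729473). CONDITIONAL on the two cluster nodes +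
`cert_pin1menuA0p_L3h0_U8_tp0_g5o7_E_j287398` (CANDIDATE). Kinematic scale; never speaks to presence. [cite: Griffiths1966, §II] -/
theorem canonicalCeiling_n7o8_tp0_clusterline_decimal_g5o28 (hω : ω.IsTranslationInvariant) (hρ : ω.density = 7 / 8)
    (hmin : ∀ ω' : InfVolFermionState 2, ω'.IsTranslationInvariant → ω'.density = 7 / 8 →
      ω.meanEnergy (hubbardTTPrimeSourcedInteraction 1 0 8 0 dWaveFormFactor (Real.sqrt 2 * (5 / 28 : ℝ))) 1 ≤
        ω'.meanEnergy (hubbardTTPrimeSourcedInteraction 1 0 8 0 dWaveFormFactor (Real.sqrt 2 * (5 / 28 : ℝ))) 1)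
    (hC₁ : cert_capU2x2_4x3_U8_tp0_g3o14_mu3o2) (hC₂ : cert_capU3x2_4x3_U8_tp0_g1o4_mu7o4) (hN : cert_pin1menuA0p_L3h0_U8_tp0_g5o7_E_j287398) :
    (ω.expect (pairRegion (insert (0 : Site 2) unitSteps) 0) (localPairAt (insert 0 unitSteps) dWaveFormFactor 0)).re ≤ (9423209 / 10000000 : ℝ) :=
  chord_le_of_decimal_bound (by norm_num) (by push_cast; norm_num) (by push_cast; norm_num)
    (canonicalCeiling_n7o8_tp0_clusterline_of_row_g5o7 (5 / 28 : ℝ) (by norm_num) (by norm_num) hω hρ hmin hC₁ hC₂ hN)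

/-- **Ceiling slot at `g = 3/14` (`h_tree ≈ 0.30305`): `Re ω(P₀^d) ≤ 0.9751287`** for every translation-invariant density-`7/8` minimiser of
`E_{√2·3/14}` (best row: `g₂ = 5/7`; exact chord `(A + B·g − E(g₂))/(2√2(g₂ − g))` rounded UP to 7 dp); no positive floor at this field (ℓ₅₀₅ chord margin -0.0241558). CONDITIONAL on the two cluster nodes +
`cert_pin1menuA0p_L3h0_U8_tp0_g5o7_E_j287398` (CANDIDATE). Kinematic scale; never speaks to presence. [cite: Griffiths1966, §II] -/
theorem canonicalCeiling_n7o8_tp0_clusterline_decimal_g3o14 (hω : ω.IsTranslationInvariant) (hρ : ω.density = 7 / 8)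
    (hmin : ∀ ω' : InfVolFermionState 2, ω'.IsTranslationInvariant → ω'.density = 7 / 8 →
      ω.meanEnergy (hubbardTTPrimeSourcedInteraction 1 0 8 0 dWaveFormFactor (Real.sqrt 2 * (3 / 14 : ℝ))) 1 ≤
        ω'.meanEnergy (hubbardTTPrimeSourcedInteraction 1 0 8 0 dWaveFormFactor (Real.sqrt 2 * (3 / 14 : ℝ))) 1)
    (hC₁ : cert_capU2x2_4x3_U8_tp0_g3o14_mu3o2) (hC₂ : cert_capU3x2_4x3_U8_tp0_g1o4_mu7o4) (hN : cert_pin1menuA0p_L3h0_U8_tp0_g5o7_E_j287398) :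
    (ω.expect (pairRegion (insert (0 : Site 2) unitSteps) 0) (localPairAt (insert 0 unitSteps) dWaveFormFactor 0)).re ≤ (9751287 / 10000000 : ℝ) :=
  chord_le_of_decimal_bound (by norm_num) (by push_cast; norm_num) (by push_cast; norm_num)
    (canonicalCeiling_n7o8_tp0_clusterline_of_row_g5o7 (3 / 14 : ℝ) (by norm_num) (by norm_num) hω hρ hmin hC₁ hC₂ hN)

/-- **Ceiling slot at `g = 1/4` (`h_tree ≈ 0.35355`): `Re ω(P₀^d) ≤ 1.0129839`** for every translation-invariant density-`7/8` minimiser of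
`E_{√2·1/4}` (best row: `g₂ = 5/7`; exact chord `(A + B·g − E(g₂))/(2√2(g₂ − g))` rounded UP to 7 dp); the p488242 floor at this field is `0.0348402` ⇒ bracket width `0.9781437`. CONDITIONAL on the two cluster nodes +
`cert_pin1menuA0p_L3h0_U8_tp0_g5o7_E_j287398` (CANDIDATE). Kinematic scale; never speaks to presence. [cite: Griffiths1966, §II] -/
theorem canonicalCeiling_n7o8_tp0_clusterline_decimal_g1o4 (hω : ω.IsTranslationInvariant) (hρ : ω.density = 7 / 8)
    (hmin : ∀ ω' : InfVolFermionState 2, ω'.IsTranslationInvariant → ω'.density = 7 / 8 →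
      ω.meanEnergy (hubbardTTPrimeSourcedInteraction 1 0 8 0 dWaveFormFactor (Real.sqrt 2 * (1 / 4 : ℝ))) 1 ≤
        ω'.meanEnergy (hubbardTTPrimeSourcedInteraction 1 0 8 0 dWaveFormFactor (Real.sqrt 2 * (1 / 4 : ℝ))) 1)
    (hC₁ : cert_capU2x2_4x3_U8_tp0_g3o14_mu3o2) (hC₂ : cert_capU3x2_4x3_U8_tp0_g1o4_mu7o4) (hN : cert_pin1menuA0p_L3h0_U8_tp0_g5o7_E_j287398) :
    (ω.expect (pairRegion (insert (0 : Site 2) unitSteps) 0) (localPairAt (insert 0 unitSteps) dWaveFormFactor 0)).re ≤ (10129839 / 10000000 : ℝ) :=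
  chord_le_of_decimal_bound (by norm_num) (by push_cast; norm_num) (by push_cast; norm_num)
    (canonicalCeiling_n7o8_tp0_clusterline_of_row_g5o7 (1 / 4 : ℝ) (by norm_num) (by norm_num) hω hρ hmin hC₁ hC₂ hN)

/-- **Ceiling slot at `g = 2/7` (`h_tree ≈ 0.40406`): `Re ω(P₀^d) ≤ 1.0571482`** for every translation-invariant density-`7/8` minimiser of
`E_{√2·2/7}` (best row: `g₂ = 5/7`; exact chord `(A + B·g − E(g₂))/(2√2(g₂ − g))` rounded UP to 7 dp); the p488242 floor at this field is `0.0908616` ⇒ bracket width `0.9662866`. CONDITIONAL on the two cluster nodes +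
`cert_pin1menuA0p_L3h0_U8_tp0_g5o7_E_j287398` (CANDIDATE). Kinematic scale; never speaks to presence. [cite: Griffiths1966, §II] -/
theorem canonicalCeiling_n7o8_tp0_clusterline_decimal_g2o7 (hω : ω.IsTranslationInvariant) (hρ : ω.density = 7 / 8)
    (hmin : ∀ ω' : InfVolFermionState 2, ω'.IsTranslationInvariant → ω'.density = 7 / 8 →
      ω.meanEnergy (hubbardTTPrimeSourcedInteraction 1 0 8 0 dWaveFormFactor (Real.sqrt 2 * (2 / 7 : ℝ))) 1 ≤
        ω'.meanEnergy (hubbardTTPrimeSourcedInteraction 1 0 8 0 dWaveFormFactor (Real.sqrt 2 * (2 / 7 : ℝ))) 1)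
    (hC₁ : cert_capU2x2_4x3_U8_tp0_g3o14_mu3o2) (hC₂ : cert_capU3x2_4x3_U8_tp0_g1o4_mu7o4) (hN : cert_pin1menuA0p_L3h0_U8_tp0_g5o7_E_j287398) :
    (ω.expect (pairRegion (insert (0 : Site 2) unitSteps) 0) (localPairAt (insert 0 unitSteps) dWaveFormFactor 0)).re ≤ (5285741 / 5000000 : ℝ) :=
  chord_le_of_decimal_bound (by norm_num) (by push_cast; norm_num) (by push_cast; norm_num)
    (canonicalCeiling_n7o8_tp0_clusterline_of_row_g5o7 (2 / 7 : ℝ) (by norm_num) (by norm_num) hω hρ hmin hC₁ hC₂ hN)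

/-- **Ceiling slot at `g = 5/14` (`h_tree ≈ 0.50508`): `Re ω(P₀^d) ≤ 1.1719756`** for every translation-invariant density-`7/8` minimiser of
`E_{√2·5/14}` (best row: `g₂ = 5/7`; exact chord `(A + B·g − E(g₂))/(2√2(g₂ − g))` rounded UP to 7 dp); the p488242 floor at this field is `0.1692915` ⇒ bracket width `1.0026841`. CONDITIONAL on the two cluster nodes +
`cert_pin1menuA0p_L3h0_U8_tp0_g5o7_E_j287398` (CANDIDATE). Kinematic scale; never speaks to presence. [cite: Griffiths1966, §II] -/
theorem canonicalCeiling_n7o8_tp0_clusterline_decimal_g5o14 (hω : ω.IsTranslationInvariant) (hρ : ω.density = 7 / 8)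
    (hmin : ∀ ω' : InfVolFermionState 2, ω'.IsTranslationInvariant → ω'.density = 7 / 8 →
      ω.meanEnergy (hubbardTTPrimeSourcedInteraction 1 0 8 0 dWaveFormFactor (Real.sqrt 2 * (5 / 14 : ℝ))) 1 ≤
        ω'.meanEnergy (hubbardTTPrimeSourcedInteraction 1 0 8 0 dWaveFormFactor (Real.sqrt 2 * (5 / 14 : ℝ))) 1)
    (hC₁ : cert_capU2x2_4x3_U8_tp0_g3o14_mu3o2) (hC₂ : cert_capU3x2_4x3_U8_tp0_g1o4_mu7o4) (hN : cert_pin1menuA0p_L3h0_U8_tp0_g5o7_E_j287398) :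
    (ω.expect (pairRegion (insert (0 : Site 2) unitSteps) 0) (localPairAt (insert 0 unitSteps) dWaveFormFactor 0)).re ≤ (2929939 / 2500000 : ℝ) :=
  chord_le_of_decimal_bound (by norm_num) (by push_cast; norm_num) (by push_cast; norm_num)
    (canonicalCeiling_n7o8_tp0_clusterline_of_row_g5o7 (5 / 14 : ℝ) (by norm_num) (by norm_num) hω hρ hmin hC₁ hC₂ hN)

/-- **Ceiling slot at `g = 3/7` (`h_tree ≈ 0.60609`): `Re ω(P₀^d) ≤ 1.3442167`** for every translation-invariant density-`7/8` minimiser of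
`E_{√2·3/7}` (best row: `g₂ = 5/7`; exact chord `(A + B·g − E(g₂))/(2√2(g₂ − g))` rounded UP to 7 dp); the p488242 floor at this field is `0.2215781` ⇒ bracket width `1.1226386`. CONDITIONAL on the two cluster nodes +
`cert_pin1menuA0p_L3h0_U8_tp0_g5o7_E_j287398` (CANDIDATE). Kinematic scale; never speaks to presence. [cite: Griffiths1966, §II] -/
theorem canonicalCeiling_n7o8_tp0_clusterline_decimal_g3o7 (hω : ω.IsTranslationInvariant) (hρ : ω.density = 7 / 8)
    (hmin : ∀ ω' : InfVolFermionState 2, ω'.IsTranslationInvariant → ω'.density = 7 / 8 →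
      ω.meanEnergy (hubbardTTPrimeSourcedInteraction 1 0 8 0 dWaveFormFactor (Real.sqrt 2 * (3 / 7 : ℝ))) 1 ≤
        ω'.meanEnergy (hubbardTTPrimeSourcedInteraction 1 0 8 0 dWaveFormFactor (Real.sqrt 2 * (3 / 7 : ℝ))) 1)
    (hC₁ : cert_capU2x2_4x3_U8_tp0_g3o14_mu3o2) (hC₂ : cert_capU3x2_4x3_U8_tp0_g1o4_mu7o4) (hN : cert_pin1menuA0p_L3h0_U8_tp0_g5o7_E_j287398) :
    (ω.expect (pairRegion (insert (0 : Site 2) unitSteps) 0) (localPairAt (insert 0 unitSteps) dWaveFormFactor 0)).re ≤ (13442167 / 10000000 : ℝ) :=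
  chord_le_of_decimal_bound (by norm_num) (by push_cast; norm_num) (by push_cast; norm_num)
    (canonicalCeiling_n7o8_tp0_clusterline_of_row_g5o7 (3 / 7 : ℝ) (by norm_num) (by norm_num) hω hρ hmin hC₁ hC₂ hN)

/-- **Ceiling slot at `g = 1/2` (`h_tree ≈ 0.70711`): `Re ω(P₀^d) ≤ 1.6312851`** for every translation-invariant density-`7/8` minimiser of
`E_{√2·1/2}` (best row: `g₂ = 5/7`; exact chord `(A + B·g − E(g₂))/(2√2(g₂ − g))` rounded UP to 7 dp); the p488242 floor at this field is `0.2589257` ⇒ bracket width `1.3723594`. CONDITIONAL on the two cluster nodes +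
`cert_pin1menuA0p_L3h0_U8_tp0_g5o7_E_j287398` (CANDIDATE). Kinematic scale; never speaks to presence. [cite: Griffiths1966, §II] -/
theorem canonicalCeiling_n7o8_tp0_clusterline_decimal_g1o2 (hω : ω.IsTranslationInvariant) (hρ : ω.density = 7 / 8)
    (hmin : ∀ ω' : InfVolFermionState 2, ω'.IsTranslationInvariant → ω'.density = 7 / 8 →
      ω.meanEnergy (hubbardTTPrimeSourcedInteraction 1 0 8 0 dWaveFormFactor (Real.sqrt 2 * (1 / 2 : ℝ))) 1 ≤
        ω'.meanEnergy (hubbardTTPrimeSourcedInteraction 1 0 8 0 dWaveFormFactor (Real.sqrt 2 * (1 / 2 : ℝ))) 1)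
    (hC₁ : cert_capU2x2_4x3_U8_tp0_g3o14_mu3o2) (hC₂ : cert_capU3x2_4x3_U8_tp0_g1o4_mu7o4) (hN : cert_pin1menuA0p_L3h0_U8_tp0_g5o7_E_j287398) :
    (ω.expect (pairRegion (insert (0 : Site 2) unitSteps) 0) (localPairAt (insert 0 unitSteps) dWaveFormFactor 0)).re ≤ (16312851 / 10000000 : ℝ) :=
  chord_le_of_decimal_bound (by norm_num) (by push_cast; norm_num) (by push_cast; norm_num)
    (canonicalCeiling_n7o8_tp0_clusterline_of_row_g5o7 (1 / 2 : ℝ) (by norm_num) (by norm_num) hω hρ hmin hC₁ hC₂ hN)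

end Decimals

/-! ## §4  Two-sided brackets where the p488242 floor is positive (floor premises `#505` + cluster nodes; ceiling premises cluster nodes + one row) -/

section Brackets

variable {ω : InfVolFermionState 2}

/-- **Two-sided bracket at `g = 1/4` (`h_tree ≈ 0.35355`): `Re ω(P₀^d) ∈ [0.0348402, 1.0129839]`** for every translation-invariant density-`7/8`
minimiser of `E_{√2·1/4}` — floor = `canonicalFloor_n7o8_tp0_clusterline_continuum` (p488242; `#505` + the two cluster nodes) rounded DOWN,
ceiling = §3 (cluster nodes + row `g₂ = 5/7`) rounded UP; width `0.9781437`. Premise sets listed separately; CANDIDATE legs named. A finite-field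
RESPONSE bracket at a large field; never order. [cite: Griffiths1966, §II] [cite: KomaTasaki1994, §1] -/
theorem twoSidedBracket_n7o8_tp0_clusterline_g1o4 (hω : ω.IsTranslationInvariant) (hρ : ω.density = 7 / 8)
    (hmin : ∀ ω' : InfVolFermionState 2, ω'.IsTranslationInvariant → ω'.density = 7 / 8 →
      ω.meanEnergy (hubbardTTPrimeSourcedInteraction 1 0 8 0 dWaveFormFactor (Real.sqrt 2 * (1 / 4 : ℝ))) 1 ≤
        ω'.meanEnergy (hubbardTTPrimeSourcedInteraction 1 0 8 0 dWaveFormFactor (Real.sqrt 2 * (1 / 4 : ℝ))) 1)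
    (h505 : cert_r505_HYB_GU8n7o8eom8_w3_b4_R2_ob5p2_kry1_kry2c3rel_menulite_core_focert_it2000)
    (hC₁ : cert_capU2x2_4x3_U8_tp0_g3o14_mu3o2) (hC₂ : cert_capU3x2_4x3_U8_tp0_g1o4_mu7o4) (hN : cert_pin1menuA0p_L3h0_U8_tp0_g5o7_E_j287398) :
    (ω.expect (pairRegion (insert (0 : Site 2) unitSteps) 0) (localPairAt (insert 0 unitSteps) dWaveFormFactor 0)).re ∈
      Set.Icc (174201 / 5000000 : ℝ) (10129839 / 10000000 : ℝ) := by
  refine ⟨?_, canonicalCeiling_n7o8_tp0_clusterline_decimal_g1o4 hω hρ hmin hC₁ hC₂ hN⟩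
  have hfl := canonicalFloor_n7o8_tp0_clusterline_continuum (1 / 4 : ℝ) (by norm_num) hω hρ hmin h505 hC₁ hC₂
  refine le_trans ?_ hfl
  have hs : Real.sqrt 2 < (14142135624 / 10 ^ 10 : ℝ) := sqrt_two_lt_14142135624
  have hs0 : 0 < Real.sqrt 2 := Real.sqrt_pos.2 (by norm_num)
  rw [le_div_iff₀ (by positivity)]
  push_cast
  nlinarith [hs, hs0]

/-- **Two-sided bracket at `g = 2/7` (`h_tree ≈ 0.40406`): `Re ω(P₀^d) ∈ [0.0908616, 1.0571482]`** for every translation-invariant density-`7/8`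
minimiser of `E_{√2·2/7}` — floor = `canonicalFloor_n7o8_tp0_clusterline_continuum` (p488242; `#505` + the two cluster nodes) rounded DOWN,
ceiling = §3 (cluster nodes + row `g₂ = 5/7`) rounded UP; width `0.9662866`. Premise sets listed separately; CANDIDATE legs named. A finite-field
RESPONSE bracket at a large field; never order. [cite: Griffiths1966, §II] [cite: KomaTasaki1994, §1] -/
theorem twoSidedBracket_n7o8_tp0_clusterline_g2o7 (hω : ω.IsTranslationInvariant) (hρ : ω.density = 7 / 8)
    (hmin : ∀ ω' : InfVolFermionState 2, ω'.IsTranslationInvariant → ω'.density = 7 / 8 →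
      ω.meanEnergy (hubbardTTPrimeSourcedInteraction 1 0 8 0 dWaveFormFactor (Real.sqrt 2 * (2 / 7 : ℝ))) 1 ≤
        ω'.meanEnergy (hubbardTTPrimeSourcedInteraction 1 0 8 0 dWaveFormFactor (Real.sqrt 2 * (2 / 7 : ℝ))) 1)
    (h505 : cert_r505_HYB_GU8n7o8eom8_w3_b4_R2_ob5p2_kry1_kry2c3rel_menulite_core_focert_it2000)
    (hC₁ : cert_capU2x2_4x3_U8_tp0_g3o14_mu3o2) (hC₂ : cert_capU3x2_4x3_U8_tp0_g1o4_mu7o4) (hN : cert_pin1menuA0p_L3h0_U8_tp0_g5o7_E_j287398) :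
    (ω.expect (pairRegion (insert (0 : Site 2) unitSteps) 0) (localPairAt (insert 0 unitSteps) dWaveFormFactor 0)).re ∈
      Set.Icc (113577 / 1250000 : ℝ) (5285741 / 5000000 : ℝ) := by
  refine ⟨?_, canonicalCeiling_n7o8_tp0_clusterline_decimal_g2o7 hω hρ hmin hC₁ hC₂ hN⟩
  have hfl := canonicalFloor_n7o8_tp0_clusterline_continuum (2 / 7 : ℝ) (by norm_num) hω hρ hmin h505 hC₁ hC₂
  refine le_trans ?_ hfl
  have hs : Real.sqrt 2 < (14142135624 / 10 ^ 10 : ℝ) := sqrt_two_lt_14142135624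
  have hs0 : 0 < Real.sqrt 2 := Real.sqrt_pos.2 (by norm_num)
  rw [le_div_iff₀ (by positivity)]
  push_cast
  nlinarith [hs, hs0]

/-- **Two-sided bracket at `g = 5/14` (`h_tree ≈ 0.50508`): `Re ω(P₀^d) ∈ [0.1692915, 1.1719756]`** for every translation-invariant density-`7/8`
minimiser of `E_{√2·5/14}` — floor = `canonicalFloor_n7o8_tp0_clusterline_continuum` (p488242; `#505` + the two cluster nodes) rounded DOWN,
ceiling = §3 (cluster nodes + row `g₂ = 5/7`) rounded UP; width `1.0026841`. Premise sets listed separately; CANDIDATE legs named. A finite-field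
RESPONSE bracket at a large field; never order. [cite: Griffiths1966, §II] [cite: KomaTasaki1994, §1] -/
theorem twoSidedBracket_n7o8_tp0_clusterline_g5o14 (hω : ω.IsTranslationInvariant) (hρ : ω.density = 7 / 8)
    (hmin : ∀ ω' : InfVolFermionState 2, ω'.IsTranslationInvariant → ω'.density = 7 / 8 →
      ω.meanEnergy (hubbardTTPrimeSourcedInteraction 1 0 8 0 dWaveFormFactor (Real.sqrt 2 * (5 / 14 : ℝ))) 1 ≤
        ω'.meanEnergy (hubbardTTPrimeSourcedInteraction 1 0 8 0 dWaveFormFactor (Real.sqrt 2 * (5 / 14 : ℝ))) 1)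
    (h505 : cert_r505_HYB_GU8n7o8eom8_w3_b4_R2_ob5p2_kry1_kry2c3rel_menulite_core_focert_it2000)
    (hC₁ : cert_capU2x2_4x3_U8_tp0_g3o14_mu3o2) (hC₂ : cert_capU3x2_4x3_U8_tp0_g1o4_mu7o4) (hN : cert_pin1menuA0p_L3h0_U8_tp0_g5o7_E_j287398) :
    (ω.expect (pairRegion (insert (0 : Site 2) unitSteps) 0) (localPairAt (insert 0 unitSteps) dWaveFormFactor 0)).re ∈
      Set.Icc (338583 / 2000000 : ℝ) (2929939 / 2500000 : ℝ) := by
  refine ⟨?_, canonicalCeiling_n7o8_tp0_clusterline_decimal_g5o14 hω hρ hmin hC₁ hC₂ hN⟩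
  have hfl := canonicalFloor_n7o8_tp0_clusterline_continuum (5 / 14 : ℝ) (by norm_num) hω hρ hmin h505 hC₁ hC₂
  refine le_trans ?_ hfl
  have hs : Real.sqrt 2 < (14142135624 / 10 ^ 10 : ℝ) := sqrt_two_lt_14142135624
  have hs0 : 0 < Real.sqrt 2 := Real.sqrt_pos.2 (by norm_num)
  rw [le_div_iff₀ (by positivity)]
  push_cast
  nlinarith [hs, hs0]

/-- **Two-sided bracket at `g = 3/7` (`h_tree ≈ 0.60609`): `Re ω(P₀^d) ∈ [0.2215781, 1.3442167]`** for every translation-invariant density-`7/8`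
minimiser of `E_{√2·3/7}` — floor = `canonicalFloor_n7o8_tp0_clusterline_continuum` (p488242; `#505` + the two cluster nodes) rounded DOWN,
ceiling = §3 (cluster nodes + row `g₂ = 5/7`) rounded UP; width `1.1226386`. Premise sets listed separately; CANDIDATE legs named. A finite-field
RESPONSE bracket at a large field; never order. [cite: Griffiths1966, §II] [cite: KomaTasaki1994, §1] -/
theorem twoSidedBracket_n7o8_tp0_clusterline_g3o7 (hω : ω.IsTranslationInvariant) (hρ : ω.density = 7 / 8)
    (hmin : ∀ ω' : InfVolFermionState 2, ω'.IsTranslationInvariant → ω'.density = 7 / 8 →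
      ω.meanEnergy (hubbardTTPrimeSourcedInteraction 1 0 8 0 dWaveFormFactor (Real.sqrt 2 * (3 / 7 : ℝ))) 1 ≤
        ω'.meanEnergy (hubbardTTPrimeSourcedInteraction 1 0 8 0 dWaveFormFactor (Real.sqrt 2 * (3 / 7 : ℝ))) 1)
    (h505 : cert_r505_HYB_GU8n7o8eom8_w3_b4_R2_ob5p2_kry1_kry2c3rel_menulite_core_focert_it2000)
    (hC₁ : cert_capU2x2_4x3_U8_tp0_g3o14_mu3o2) (hC₂ : cert_capU3x2_4x3_U8_tp0_g1o4_mu7o4) (hN : cert_pin1menuA0p_L3h0_U8_tp0_g5o7_E_j287398) :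
    (ω.expect (pairRegion (insert (0 : Site 2) unitSteps) 0) (localPairAt (insert 0 unitSteps) dWaveFormFactor 0)).re ∈
      Set.Icc (2215781 / 10000000 : ℝ) (13442167 / 10000000 : ℝ) := by
  refine ⟨?_, canonicalCeiling_n7o8_tp0_clusterline_decimal_g3o7 hω hρ hmin hC₁ hC₂ hN⟩
  have hfl := canonicalFloor_n7o8_tp0_clusterline_continuum (3 / 7 : ℝ) (by norm_num) hω hρ hmin h505 hC₁ hC₂
  refine le_trans ?_ hfl
  have hs : Real.sqrt 2 < (14142135624 / 10 ^ 10 : ℝ) := sqrt_two_lt_14142135624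
  have hs0 : 0 < Real.sqrt 2 := Real.sqrt_pos.2 (by norm_num)
  rw [le_div_iff₀ (by positivity)]
  push_cast
  nlinarith [hs, hs0]

/-- **Two-sided bracket at `g = 1/2` (`h_tree ≈ 0.70711`): `Re ω(P₀^d) ∈ [0.2589257, 1.6312851]`** for every translation-invariant density-`7/8`
minimiser of `E_{√2·1/2}` — floor = `canonicalFloor_n7o8_tp0_clusterline_continuum` (p488242; `#505` + the two cluster nodes) rounded DOWN,
ceiling = §3 (cluster nodes + row `g₂ = 5/7`) rounded UP; width `1.3723594`. Premise sets listed separately; CANDIDATE legs named. A finite-field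
RESPONSE bracket at a large field; never order. [cite: Griffiths1966, §II] [cite: KomaTasaki1994, §1] -/
theorem twoSidedBracket_n7o8_tp0_clusterline_g1o2 (hω : ω.IsTranslationInvariant) (hρ : ω.density = 7 / 8)
    (hmin : ∀ ω' : InfVolFermionState 2, ω'.IsTranslationInvariant → ω'.density = 7 / 8 →
      ω.meanEnergy (hubbardTTPrimeSourcedInteraction 1 0 8 0 dWaveFormFactor (Real.sqrt 2 * (1 / 2 : ℝ))) 1 ≤
        ω'.meanEnergy (hubbardTTPrimeSourcedInteraction 1 0 8 0 dWaveFormFactor (Real.sqrt 2 * (1 / 2 : ℝ))) 1)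
    (h505 : cert_r505_HYB_GU8n7o8eom8_w3_b4_R2_ob5p2_kry1_kry2c3rel_menulite_core_focert_it2000)
    (hC₁ : cert_capU2x2_4x3_U8_tp0_g3o14_mu3o2) (hC₂ : cert_capU3x2_4x3_U8_tp0_g1o4_mu7o4) (hN : cert_pin1menuA0p_L3h0_U8_tp0_g5o7_E_j287398) :
    (ω.expect (pairRegion (insert (0 : Site 2) unitSteps) 0) (localPairAt (insert 0 unitSteps) dWaveFormFactor 0)).re ∈
      Set.Icc (2589257 / 10000000 : ℝ) (16312851 / 10000000 : ℝ) := by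
  refine ⟨?_, canonicalCeiling_n7o8_tp0_clusterline_decimal_g1o2 hω hρ hmin hC₁ hC₂ hN⟩
  have hfl := canonicalFloor_n7o8_tp0_clusterline_continuum (1 / 2 : ℝ) (by norm_num) hω hρ hmin h505 hC₁ hC₂
  refine le_trans ?_ hfl
  have hs : Real.sqrt 2 < (14142135624 / 10 ^ 10 : ℝ) := sqrt_two_lt_14142135624
  have hs0 : 0 < Real.sqrt 2 := Real.sqrt_pos.2 (by norm_num)
  rw [le_div_iff₀ (by positivity)]
  push_cast
  nlinarith [hs, hs0]

end Brackets

/-! ## §5  APPEND (hubbard-floor-eng-1 job S1 = kit j313009, 2026-08-28): ceiling slots via the NEW `6/7` row `cert_pin1menuA0p_L3h0_U8_tp0_g6o7_E_j313009` (h₂ ≈ 1.21218), which beats the `5/7` partner at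
# every grid field g ≥ 5/28: 0.9414397 @ 0.25254 (was 0.9423209) · 0.9669079 @ 0.30305 (was 0.9751287) · 0.9953724 @ 0.35355 (was 1.0129839) · 1.0273950 @ 0.40406 (was 1.0571482) · 1.1051641 @ 0.50508 (was 1.1719756) · 1.2088562 @ 0.60609 (was 1.3442167) · 1.3540252 @ 0.70711 (was 1.6312851) -/

section DecimalsS1

variable {ω : InfVolFermionState 2}

/-- **Ceiling slot at `g = 5/28` (`h_tree ≈ 0.25254`) via the NEW `6/7` row: `Re ω(P₀^d) ≤ 0.9414397`** for every translation-invariant density-`7/8` minimiser of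
`E_{√2·5/28}` (7 dp UP; the `5/7`-row slot was `0.9423209`). CONDITIONAL on the two cluster nodes + `cert_pin1menuA0p_L3h0_U8_tp0_g6o7_E_j313009` (CANDIDATE, job S1 kit j313009). Kinematic scale. [cite: Griffiths1966, §II] -/
theorem canonicalCeiling_n7o8_tp0_clusterline_decimal_g5o28_r6o7 (hω : ω.IsTranslationInvariant) (hρ : ω.density = 7 / 8)
    (hmin : ∀ ω' : InfVolFermionState 2, ω'.IsTranslationInvariant → ω'.density = 7 / 8 →
      ω.meanEnergy (hubbardTTPrimeSourcedInteraction 1 0 8 0 dWaveFormFactor (Real.sqrt 2 * (5 / 28 : ℝ))) 1 ≤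
        ω'.meanEnergy (hubbardTTPrimeSourcedInteraction 1 0 8 0 dWaveFormFactor (Real.sqrt 2 * (5 / 28 : ℝ))) 1)
    (hC₁ : cert_capU2x2_4x3_U8_tp0_g3o14_mu3o2) (hC₂ : cert_capU3x2_4x3_U8_tp0_g1o4_mu7o4) (hN : cert_pin1menuA0p_L3h0_U8_tp0_g6o7_E_j313009) :
    (ω.expect (pairRegion (insert (0 : Site 2) unitSteps) 0) (localPairAt (insert 0 unitSteps) dWaveFormFactor 0)).re ≤ (9414397 / 10000000 : ℝ) :=
  chord_le_of_decimal_bound (by norm_num) (by push_cast; norm_num) (by push_cast; norm_num)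
    (canonicalCeiling_n7o8_tp0_clusterline_of_row_g6o7 (5 / 28 : ℝ) (by norm_num) (by norm_num) hω hρ hmin hC₁ hC₂ hN)

/-- **Ceiling slot at `g = 3/14` (`h_tree ≈ 0.30305`) via the NEW `6/7` row: `Re ω(P₀^d) ≤ 0.9669079`** for every translation-invariant density-`7/8` minimiser of
`E_{√2·3/14}` (7 dp UP; the `5/7`-row slot was `0.9751287`). CONDITIONAL on the two cluster nodes + `cert_pin1menuA0p_L3h0_U8_tp0_g6o7_E_j313009` (CANDIDATE, job S1 kit j313009). Kinematic scale. [cite: Griffiths1966, §II] -/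
theorem canonicalCeiling_n7o8_tp0_clusterline_decimal_g3o14_r6o7 (hω : ω.IsTranslationInvariant) (hρ : ω.density = 7 / 8)
    (hmin : ∀ ω' : InfVolFermionState 2, ω'.IsTranslationInvariant → ω'.density = 7 / 8 →
      ω.meanEnergy (hubbardTTPrimeSourcedInteraction 1 0 8 0 dWaveFormFactor (Real.sqrt 2 * (3 / 14 : ℝ))) 1 ≤
        ω'.meanEnergy (hubbardTTPrimeSourcedInteraction 1 0 8 0 dWaveFormFactor (Real.sqrt 2 * (3 / 14 : ℝ))) 1)
    (hC₁ : cert_capU2x2_4x3_U8_tp0_g3o14_mu3o2) (hC₂ : cert_capU3x2_4x3_U8_tp0_g1o4_mu7o4) (hN : cert_pin1menuA0p_L3h0_U8_tp0_g6o7_E_j313009) :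
    (ω.expect (pairRegion (insert (0 : Site 2) unitSteps) 0) (localPairAt (insert 0 unitSteps) dWaveFormFactor 0)).re ≤ (9669079 / 10000000 : ℝ) :=
  chord_le_of_decimal_bound (by norm_num) (by push_cast; norm_num) (by push_cast; norm_num)
    (canonicalCeiling_n7o8_tp0_clusterline_of_row_g6o7 (3 / 14 : ℝ) (by norm_num) (by norm_num) hω hρ hmin hC₁ hC₂ hN)

/-- **Ceiling slot at `g = 1/4` (`h_tree ≈ 0.35355`) via the NEW `6/7` row: `Re ω(P₀^d) ≤ 0.9953724`** for every translation-invariant density-`7/8` minimiser of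
`E_{√2·1/4}` (7 dp UP; the `5/7`-row slot was `1.0129839`). CONDITIONAL on the two cluster nodes + `cert_pin1menuA0p_L3h0_U8_tp0_g6o7_E_j313009` (CANDIDATE, job S1 kit j313009). Kinematic scale. [cite: Griffiths1966, §II] -/
theorem canonicalCeiling_n7o8_tp0_clusterline_decimal_g1o4_r6o7 (hω : ω.IsTranslationInvariant) (hρ : ω.density = 7 / 8)
    (hmin : ∀ ω' : InfVolFermionState 2, ω'.IsTranslationInvariant → ω'.density = 7 / 8 →
      ω.meanEnergy (hubbardTTPrimeSourcedInteraction 1 0 8 0 dWaveFormFactor (Real.sqrt 2 * (1 / 4 : ℝ))) 1 ≤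
        ω'.meanEnergy (hubbardTTPrimeSourcedInteraction 1 0 8 0 dWaveFormFactor (Real.sqrt 2 * (1 / 4 : ℝ))) 1)
    (hC₁ : cert_capU2x2_4x3_U8_tp0_g3o14_mu3o2) (hC₂ : cert_capU3x2_4x3_U8_tp0_g1o4_mu7o4) (hN : cert_pin1menuA0p_L3h0_U8_tp0_g6o7_E_j313009) :
    (ω.expect (pairRegion (insert (0 : Site 2) unitSteps) 0) (localPairAt (insert 0 unitSteps) dWaveFormFactor 0)).re ≤ (2488431 / 2500000 : ℝ) :=
  chord_le_of_decimal_bound (by norm_num) (by push_cast; norm_num) (by push_cast; norm_num)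
    (canonicalCeiling_n7o8_tp0_clusterline_of_row_g6o7 (1 / 4 : ℝ) (by norm_num) (by norm_num) hω hρ hmin hC₁ hC₂ hN)

/-- **Ceiling slot at `g = 2/7` (`h_tree ≈ 0.40406`) via the NEW `6/7` row: `Re ω(P₀^d) ≤ 1.0273950`** for every translation-invariant density-`7/8` minimiser of
`E_{√2·2/7}` (7 dp UP; the `5/7`-row slot was `1.0571482`). CONDITIONAL on the two cluster nodes + `cert_pin1menuA0p_L3h0_U8_tp0_g6o7_E_j313009` (CANDIDATE, job S1 kit j313009). Kinematic scale. [cite: Griffiths1966, §II] -/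
theorem canonicalCeiling_n7o8_tp0_clusterline_decimal_g2o7_r6o7 (hω : ω.IsTranslationInvariant) (hρ : ω.density = 7 / 8)
    (hmin : ∀ ω' : InfVolFermionState 2, ω'.IsTranslationInvariant → ω'.density = 7 / 8 →
      ω.meanEnergy (hubbardTTPrimeSourcedInteraction 1 0 8 0 dWaveFormFactor (Real.sqrt 2 * (2 / 7 : ℝ))) 1 ≤
        ω'.meanEnergy (hubbardTTPrimeSourcedInteraction 1 0 8 0 dWaveFormFactor (Real.sqrt 2 * (2 / 7 : ℝ))) 1)
    (hC₁ : cert_capU2x2_4x3_U8_tp0_g3o14_mu3o2) (hC₂ : cert_capU3x2_4x3_U8_tp0_g1o4_mu7o4) (hN : cert_pin1menuA0p_L3h0_U8_tp0_g6o7_E_j313009) :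
    (ω.expect (pairRegion (insert (0 : Site 2) unitSteps) 0) (localPairAt (insert 0 unitSteps) dWaveFormFactor 0)).re ≤ (205479 / 200000 : ℝ) :=
  chord_le_of_decimal_bound (by norm_num) (by push_cast; norm_num) (by push_cast; norm_num)
    (canonicalCeiling_n7o8_tp0_clusterline_of_row_g6o7 (2 / 7 : ℝ) (by norm_num) (by norm_num) hω hρ hmin hC₁ hC₂ hN)

/-- **Ceiling slot at `g = 5/14` (`h_tree ≈ 0.50508`) via the NEW `6/7` row: `Re ω(P₀^d) ≤ 1.1051641`** for every translation-invariant density-`7/8` minimiser of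
`E_{√2·5/14}` (7 dp UP; the `5/7`-row slot was `1.1719756`). CONDITIONAL on the two cluster nodes + `cert_pin1menuA0p_L3h0_U8_tp0_g6o7_E_j313009` (CANDIDATE, job S1 kit j313009). Kinematic scale. [cite: Griffiths1966, §II] -/
theorem canonicalCeiling_n7o8_tp0_clusterline_decimal_g5o14_r6o7 (hω : ω.IsTranslationInvariant) (hρ : ω.density = 7 / 8)
    (hmin : ∀ ω' : InfVolFermionState 2, ω'.IsTranslationInvariant → ω'.density = 7 / 8 →
      ω.meanEnergy (hubbardTTPrimeSourcedInteraction 1 0 8 0 dWaveFormFactor (Real.sqrt 2 * (5 / 14 : ℝ))) 1 ≤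
        ω'.meanEnergy (hubbardTTPrimeSourcedInteraction 1 0 8 0 dWaveFormFactor (Real.sqrt 2 * (5 / 14 : ℝ))) 1)
    (hC₁ : cert_capU2x2_4x3_U8_tp0_g3o14_mu3o2) (hC₂ : cert_capU3x2_4x3_U8_tp0_g1o4_mu7o4) (hN : cert_pin1menuA0p_L3h0_U8_tp0_g6o7_E_j313009) :
    (ω.expect (pairRegion (insert (0 : Site 2) unitSteps) 0) (localPairAt (insert 0 unitSteps) dWaveFormFactor 0)).re ≤ (11051641 / 10000000 : ℝ) :=
  chord_le_of_decimal_bound (by norm_num) (by push_cast; norm_num) (by push_cast; norm_num)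
    (canonicalCeiling_n7o8_tp0_clusterline_of_row_g6o7 (5 / 14 : ℝ) (by norm_num) (by norm_num) hω hρ hmin hC₁ hC₂ hN)

/-- **Ceiling slot at `g = 3/7` (`h_tree ≈ 0.60609`) via the NEW `6/7` row: `Re ω(P₀^d) ≤ 1.2088562`** for every translation-invariant density-`7/8` minimiser of
`E_{√2·3/7}` (7 dp UP; the `5/7`-row slot was `1.3442167`). CONDITIONAL on the two cluster nodes + `cert_pin1menuA0p_L3h0_U8_tp0_g6o7_E_j313009` (CANDIDATE, job S1 kit j313009). Kinematic scale. [cite: Griffiths1966, §II] -/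
theorem canonicalCeiling_n7o8_tp0_clusterline_decimal_g3o7_r6o7 (hω : ω.IsTranslationInvariant) (hρ : ω.density = 7 / 8)
    (hmin : ∀ ω' : InfVolFermionState 2, ω'.IsTranslationInvariant → ω'.density = 7 / 8 →
      ω.meanEnergy (hubbardTTPrimeSourcedInteraction 1 0 8 0 dWaveFormFactor (Real.sqrt 2 * (3 / 7 : ℝ))) 1 ≤
        ω'.meanEnergy (hubbardTTPrimeSourcedInteraction 1 0 8 0 dWaveFormFactor (Real.sqrt 2 * (3 / 7 : ℝ))) 1)
    (hC₁ : cert_capU2x2_4x3_U8_tp0_g3o14_mu3o2) (hC₂ : cert_capU3x2_4x3_U8_tp0_g1o4_mu7o4) (hN : cert_pin1menuA0p_L3h0_U8_tp0_g6o7_E_j313009) :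
    (ω.expect (pairRegion (insert (0 : Site 2) unitSteps) 0) (localPairAt (insert 0 unitSteps) dWaveFormFactor 0)).re ≤ (6044281 / 5000000 : ℝ) :=
  chord_le_of_decimal_bound (by norm_num) (by push_cast; norm_num) (by push_cast; norm_num)
    (canonicalCeiling_n7o8_tp0_clusterline_of_row_g6o7 (3 / 7 : ℝ) (by norm_num) (by norm_num) hω hρ hmin hC₁ hC₂ hN)

/-- **Ceiling slot at `g = 1/2` (`h_tree ≈ 0.70711`) via the NEW `6/7` row: `Re ω(P₀^d) ≤ 1.3540252`** for every translation-invariant density-`7/8` minimiser of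
`E_{√2·1/2}` (7 dp UP; the `5/7`-row slot was `1.6312851`). CONDITIONAL on the two cluster nodes + `cert_pin1menuA0p_L3h0_U8_tp0_g6o7_E_j313009` (CANDIDATE, job S1 kit j313009). Kinematic scale. [cite: Griffiths1966, §II] -/
theorem canonicalCeiling_n7o8_tp0_clusterline_decimal_g1o2_r6o7 (hω : ω.IsTranslationInvariant) (hρ : ω.density = 7 / 8)
    (hmin : ∀ ω' : InfVolFermionState 2, ω'.IsTranslationInvariant → ω'.density = 7 / 8 →
      ω.meanEnergy (hubbardTTPrimeSourcedInteraction 1 0 8 0 dWaveFormFactor (Real.sqrt 2 * (1 / 2 : ℝ))) 1 ≤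
        ω'.meanEnergy (hubbardTTPrimeSourcedInteraction 1 0 8 0 dWaveFormFactor (Real.sqrt 2 * (1 / 2 : ℝ))) 1)
    (hC₁ : cert_capU2x2_4x3_U8_tp0_g3o14_mu3o2) (hC₂ : cert_capU3x2_4x3_U8_tp0_g1o4_mu7o4) (hN : cert_pin1menuA0p_L3h0_U8_tp0_g6o7_E_j313009) :
    (ω.expect (pairRegion (insert (0 : Site 2) unitSteps) 0) (localPairAt (insert 0 unitSteps) dWaveFormFactor 0)).re ≤ (3385063 / 2500000 : ℝ) :=
  chord_le_of_decimal_bound (by norm_num) (by push_cast; norm_num) (by push_cast; norm_num)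
    (canonicalCeiling_n7o8_tp0_clusterline_of_row_g6o7 (1 / 2 : ℝ) (by norm_num) (by norm_num) hω hρ hmin hC₁ hC₂ hN)

end DecimalsS1


end Summit.Ventures.CertifiedManyBodySolver.Observables

end
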